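import Literature.Geometry.Riemannian.HeatKernelGaussianConcentration
import HarnessLib

/-!
# The Gaussian integral bound for the conjugate heat kernel measures at an `H_m`-centre
# (Bamler 2020a, Thm. 3.12, in kernel form)

R. Bamler, *Entropy and heat kernel bounds on a Ricci flow background*, arXiv:2008.07093 (2020a),
§3, Thm. 3.12 (arXiv v1: Thm. 13): if `(z, s)` is an `H_n`-centre of `(x, t)`, `τ = t − s > 0`,
i.e. `Var_s(δ_z, ν_{x,t;s}) = ∫ d_s(z, ·)² dν_{x,t;s} ≤ H_n τ` with `H_n = (n − 1)π²/2 + 4`, then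

  `ν_{x,t;s}(M ∖ B(z, s, r)) ≤ 2 exp(−(r − √(2 H_n τ))₊² / (8τ))`   for all `r ≥ 0`.

Bamler's proof: "The first bound follows from [Hein–Naber-14] applied to the subsets
`B(z, s, √(2 H_n τ))`, `M ∖ B(z, s, r)` using Proposition 3.11" (`ν(B(z, √(A H_n τ))) ≥ 1 − 1/A`,
here `A = 2`, which is Chebyshev's inequality for the variance bound).

This file proves exactly this (`heatKernelMeasure_real_setOf_le_edist_le`) for a Ricci flow
`hflow = (h, cov)` on `[a, T]` of a `C^∞` family of Riemannian metrics on a closed connected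
manifold `M` modelled on `ℝᵐ`, `a < s < t ≤ T`, the tree's heat kernel measures
`ν = heatKernelMeasure hh hR t x s` (`HeatKernelMeasures.lean`) and Riemannian distance
`(h s).edist (hR s)` (`RiemannianDistance.lean`); the `H_m`-centre hypothesis is the `lintegral`
variance bound `∫⁻ d_s(z, y)² dν(y) ≤ H_m (t − s)` and the complement of the ball is the super-level
set `{y | r ≤ d_s(z, y)}`. The Hein–Naber input is the tree's Gaussian concentration theorem
`heatKernelMeasure_real_mul_real_le_exp` (`HeatKernelGaussianConcentration.lean`), applied with
the `1`-Lipschitz witness `ψ = d_s(z, ·)`, `A = {d_s(z, ·) ≤ ρ}`, `B = {r ≤ d_s(z, ·)}`,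
`ρ = √(2 H_m τ)`: `ν(A) ν(B) ≤ exp(−(r − ρ)²/(8τ))`, and `ν(A) ≥ 1/2` by Chebyshev.

Everything is proved; no definitions, no named facts. What is NOT here: the notion of an
`H_n`-centre as a definition and their existence (Bamler 2020a, Prop. 3.13 / Cor. 3.8, the
variance bound `Var(δ_z, ν_{x,t;s}) ≤ H_n (t − s)` itself), the second bound of Thm. 3.12
(the `W₁`-distance form `d_{W₁}^{g_s}(δ_z, ν_{x,t;s}) ≤ √(H_n τ) …`), non-compact `M`.

## References

* R. H. Bamler, *Entropy and heat kernel bounds on a Ricci flow background*, arXiv:2008.07093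
  (2020), §3.1, Prop. 3.11, Thm. 3.12. [Bamler2020Entropy]
* H.-J. Hein, A. Naber, *New logarithmic Sobolev inequalities and an ε-regularity theorem for the
  Ricci flow*, Comm. Pure Appl. Math. 67 (2014), 1543–1561, §1.3 (Gaussian concentration).
  [HeinNaber2014]
-/

noncomputable section

open Bundle Set Function Filter Manifold MeasureTheory Measure TopologicalSpace
open scoped Manifold ContDiff Topology ENNReal NNReal

namespace Literature.Geometry.Riemannian

open Lorentzian Lorentzian.PseudoRiemannianMetric

section IntegralBound

/-- **Chebyshev for the distance from a centre** (Bamler 2020a, Prop. 3.11 with `A = 2`: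
`ν(B(z, √(A H τ))) ≥ 1 − 1/A` from `Var(δ_z, ν) ≤ H τ`): if a measure `ν` on `X` satisfies
`∫⁻ f² dν ≤ c` for a continuous `f : X → [0, ∞]` (e.g. `f = d(z, ·)`), then
`ν {y | √(2c) < f y} ≤ 1/2` — Markov's inequality for `f²` at level `2c`; for `c ≤ 0` the
integral vanishes, `f = 0` a.e., and the set is null. [cite: Bamler2020Entropy, §3.1, Prop. 3.11] -/
theorem measure_setOf_sqrt_lt_le_half {X : Type*} [TopologicalSpace X] [MeasurableSpace X]
    [OpensMeasurableSpace X] (ν : Measure X) {f : X → ℝ≥0∞} (hf : Continuous f) {c : ℝ}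
    (hν : ∫⁻ y, f y ^ 2 ∂ν ≤ ENNReal.ofReal c) :
    ν {y | ENNReal.ofReal (Real.sqrt (2 * c)) < f y} ≤ 2⁻¹ := by
  have hf2 : Measurable fun y ↦ f y ^ 2 := ((ENNReal.continuous_pow 2).comp hf).measurable
  rcases le_or_gt c 0 with hc | hc
  · -- degenerate case: the integral vanishes, `f = 0` a.e.
    have h0 : ∫⁻ y, f y ^ 2 ∂ν = 0 :=
      le_antisymm (hν.trans_eq (ENNReal.ofReal_of_nonpos hc)) (zero_le)
    have hae := (lintegral_eq_zero_iff hf2).1 h0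
    refine (le_of_eq ?_).trans (zero_le)
    rw [measure_eq_zero_iff_ae_notMem]
    filter_upwards [hae] with y hy
    have hy0 : f y = 0 := by simpa using hy
    simp [hy0]
  · -- Chebyshev: `ofReal (2c) · ν {ofReal (2c) ≤ f²} ≤ ∫⁻ f² ≤ ofReal c`
    have hmarkov := mul_meas_ge_le_lintegral₀ (μ := ν) hf2.aemeasurable (ENNReal.ofReal (2 * c))
    have hsub : {y | ENNReal.ofReal (Real.sqrt (2 * c)) < f y} ⊆
        {y | ENNReal.ofReal (2 * c) ≤ f y ^ 2} := by
      intro y hy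
      rw [mem_setOf_eq] at hy ⊢
      rw [← Real.sq_sqrt (by positivity : (0 : ℝ) ≤ 2 * c), ENNReal.ofReal_pow (Real.sqrt_nonneg _)]
      exact pow_le_pow_left' hy.le 2
    have hc0 : ENNReal.ofReal c ≠ 0 := by simpa using hc
    have h2c : ENNReal.ofReal (2 * c) = ENNReal.ofReal c * 2 := by
      rw [mul_comm, ENNReal.ofReal_mul hc.le, ENNReal.ofReal_ofNat]
    have hle : ENNReal.ofReal c * (2 * ν {y | ENNReal.ofReal (Real.sqrt (2 * c)) < f y}) ≤
        ENNReal.ofReal c * 1 := by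
      calc ENNReal.ofReal c * (2 * ν {y | ENNReal.ofReal (Real.sqrt (2 * c)) < f y})
          ≤ ENNReal.ofReal c * (2 * ν {y | ENNReal.ofReal (2 * c) ≤ f y ^ 2}) := by
            gcongr
        _ = ENNReal.ofReal (2 * c) * ν {y | ENNReal.ofReal (2 * c) ≤ f y ^ 2} := by
            rw [h2c, mul_assoc]
        _ ≤ ENNReal.ofReal c := hmarkov.trans hν
        _ = ENNReal.ofReal c * 1 := (mul_one _).symm
    have h2 := (ENNReal.mul_le_mul_iff_right hc0 ENNReal.ofReal_ne_top).1 hle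
    rw [mul_comm] at h2
    exact (ENNReal.le_inv_iff_mul_le).2 h2

/-- **Gaussian integral bound at an `H_m`-centre** (Bamler 2020a, Thm. 3.12, first bound, in
kernel form; arXiv v1: Thm. 13). Let `(h, cov)` be a Ricci flow on `[a, T]` of a smooth family of
Riemannian metrics on a closed connected manifold `M` modelled on `ℝᵐ`, `a < s < t ≤ T`,
`x ∈ M`, `ν = ν_{x,t;s}` the conjugate heat kernel measure, and let `z` be an `H_m`-centre of
`(x, t)` at time `s`: `∫ d_s(z, y)² dν(y) ≤ H_m (t − s)`, `H_m = (m − 1)π²/2 + 4`. Then for every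
`r ≥ 0` (the sign hypothesis is part of the statement but not needed in the proof)

  `ν {y | r ≤ d_s(z, y)} ≤ 2 exp(−(r − √(2 H_m (t − s)))₊² / (8 (t − s)))`.

Proof (Bamler): Hein–Naber's Gaussian concentration `heatKernelMeasure_real_mul_real_le_exp` for
`A = {d_s(z, ·) ≤ ρ}`, `B = {r ≤ d_s(z, ·)}`, `ρ = √(2 H_m τ)`, witness `ψ = d_s(z, ·)`, gives
`ν(A) ν(B) ≤ exp(−(r − ρ)²/(8τ))` for `r > ρ`, and `ν(A) ≥ 1/2` by Chebyshev
(`measure_setOf_sqrt_lt_le_half`, Bamler's Prop. 3.11); for `r ≤ ρ` the bound is `≥ 2`.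
[cite: Bamler2020Entropy, §3.1, Thm. 3.12] -/
theorem heatKernelMeasure_real_setOf_le_edist_le {m : ℕ} {H : Type*} [TopologicalSpace H]
    {I : ModelWithCorners ℝ (EuclideanSpace ℝ (Fin m)) H} [I.Boundaryless]
    {M : Type*} [TopologicalSpace M] [ChartedSpace H M] [IsManifold I ∞ M]
    [T2Space M] [CompactSpace M] [SecondCountableTopology M] [MeasurableSpace M] [BorelSpace M]
    [PreconnectedSpace M] [T3Space M]
    {h : ℝ → PseudoRiemannianMetric I ∞ (EuclideanSpace ℝ (Fin m)) (TangentSpace I : M → Type _)}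
    {cov : ℝ → CovariantDerivative I (EuclideanSpace ℝ (Fin m)) (TangentSpace I : M → Type _)}
    {a T : ℝ} (hflow : IsRicciFlow h cov (Icc a T))
    (hh : IsContMDiffFamilyOn ∞ h univ) (hR : ∀ r, (h r).IsRiemannian) {s t : ℝ} (has : a < s)
    (hst : s < t) (htT : t ≤ T) (x z : M)
    (hz : ∫⁻ y, (h s).edist (hR s) z y ^ 2 ∂(heatKernelMeasure hh hR t x s) ≤
      ENNReal.ofReal ((((m : ℝ) - 1) * Real.pi ^ 2 / 2 + 4) * (t - s)))
    (r : ℝ) (_hr : 0 ≤ r) :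
    (heatKernelMeasure hh hR t x s).real {y | ENNReal.ofReal r ≤ (h s).edist (hR s) z y} ≤
      2 * Real.exp (-(max (r - Real.sqrt (2 * ((((m : ℝ) - 1) * Real.pi ^ 2 / 2 + 4) * (t - s))))
        0) ^ 2 / (8 * (t - s))) := by
  set ν := heatKernelMeasure hh hR t x s with hν
  set ρ : ℝ := Real.sqrt (2 * ((((m : ℝ) - 1) * Real.pi ^ 2 / 2 + 4) * (t - s))) with hρ
  have hρ0 : 0 ≤ ρ := Real.sqrt_nonneg _
  set B : Set M := {y | ENNReal.ofReal r ≤ (h s).edist (hR s) z y} with hB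
  -- the trivial case `r ≤ ρ`: the right-hand side is `2`
  rcases le_or_gt r ρ with hrρ | hrρ
  · rw [max_eq_right (sub_nonpos.2 hrρ)]
    norm_num
    exact measureReal_le_one.trans one_le_two
  -- the main case `ρ < r`
  rw [max_eq_left (sub_pos.2 hrρ).le]
  have hcont : Continuous fun y ↦ (h s).edist (hR s) z y :=
    ((h s).continuous_edist (hR s)).comp (.prodMk_right z)
  have hfin : ∀ y, (h s).edist (hR s) z y ≠ ⊤ := fun y ↦
    PseudoRiemannianMetric.edist_ne_top (hR s) z y
  set A : Set M := {y | (h s).edist (hR s) z y ≤ ENNReal.ofReal ρ} with hA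
  have hAm : MeasurableSet A := measurableSet_le hcont.measurable measurable_const
  have hBm : MeasurableSet B := measurableSet_le measurable_const hcont.measurable
  -- the `1`-Lipschitz witness `ψ = d_s(z, ·)`
  set ψ : M → ℝ := fun y ↦ ((h s).edist (hR s) z y).toReal with hψ
  have hψc : Continuous ψ := continuous_iff_continuousAt.2 fun y ↦
    (ENNReal.tendsto_toReal (hfin y)).comp (hcont.tendsto y)
  have hψL : ∀ y w, ENNReal.ofReal |ψ y - ψ w| ≤ (h s).edist (hR s) y w := by
    intro y w
    have hyw : (h s).edist (hR s) y w ≠ ⊤ := PseudoRiemannianMetric.edist_ne_top (hR s) y w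
    refine ENNReal.ofReal_le_of_le_toReal (abs_sub_le_iff.2 ⟨?_, ?_⟩)
    · have h1 : (h s).edist (hR s) z y ≤ (h s).edist (hR s) z w + (h s).edist (hR s) y w := by
        rw [PseudoRiemannianMetric.edist_comm (hR s) y w]
        exact PseudoRiemannianMetric.edist_triangle (hR s) z w y
      have h2 := ENNReal.toReal_mono (ENNReal.add_ne_top.2 ⟨hfin w, hyw⟩) h1
      rw [ENNReal.toReal_add (hfin w) hyw] at h2
      simp only [hψ]
      linarith
    · have h1 : (h s).edist (hR s) z w ≤ (h s).edist (hR s) z y + (h s).edist (hR s) y w :=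
        PseudoRiemannianMetric.edist_triangle (hR s) z y w
      have h2 := ENNReal.toReal_mono (ENNReal.add_ne_top.2 ⟨hfin y, hyw⟩) h1
      rw [ENNReal.toReal_add (hfin y) hyw] at h2
      simp only [hψ]
      linarith
  have hAψ : ∀ y ∈ A, ψ y ≤ ρ := fun y hy ↦
    (ENNReal.le_ofReal_iff_toReal_le (hfin y) hρ0).1 hy
  have hBψ : ∀ y ∈ B, ρ + (r - ρ) ≤ ψ y := fun y hy ↦ by
    rw [add_sub_cancel]
    exact (ENNReal.ofReal_le_iff_le_toReal (hfin y)).1 hy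
  -- Hein–Naber's Gaussian concentration
  have hconc := heatKernelMeasure_real_mul_real_le_exp hflow hh hR has hst htT x hψc hψL hAm hBm
    (sub_pos.2 hrρ).le hAψ hBψ
  -- Chebyshev: `ν(A) ≥ 1/2`
  have hC : ν {y | ENNReal.ofReal ρ < (h s).edist (hR s) z y} ≤ 2⁻¹ :=
    measure_setOf_sqrt_lt_le_half ν hcont hz
  have hAc : Aᶜ = {y | ENNReal.ofReal ρ < (h s).edist (hR s) z y} := by
    ext y
    simp [hA]
  have hCreal : ν.real Aᶜ ≤ 2⁻¹ := by
    rw [hAc, measureReal_def]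
    have := ENNReal.toReal_mono (by simp) hC
    simpa using this
  have hAreal : 2⁻¹ ≤ ν.real A := by
    have hsum := measureReal_add_measureReal_compl (μ := ν) hAm
    rw [probReal_univ] at hsum
    linarith
  -- conclusion
  have hBnn : 0 ≤ ν.real B := measureReal_nonneg
  calc ν.real B ≤ 2 * (ν.real A * ν.real B) := by nlinarith
    _ ≤ 2 * Real.exp (-(r - ρ) ^ 2 / (8 * (t - s))) := by linarith

end IntegralBound

end Literature.Geometry.Riemannian
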